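import Summits.BirchSwinnertonDyer.Rank1Residual.Additive.AdditiveFixedPointsTorsion
import Summits.BirchSwinnertonDyer.Rank1Residual.Additive.GoodModelKernelRationalPoints
import Summits.BirchSwinnertonDyer.Rank1Residual.X2.GreenbergVatsalReductionDatum
import Summits.BirchSwinnertonDyer.Rank1Residual.Iwasawa.LocalTowerKernelNumericTest
import Literature.NumberTheory.EllipticCurves.OrdinaryLocalReductionMapProofs
import Literature.NumberTheory.EllipticCurves.HasseWeilGoodReductionFrobeniusProofs
import HarnessLib

/-!
# `Γ_{ℚ_v}`-fixed points of `E(K̄_v)` at a GOOD place `v ∋ p` (`p ∤ Δ_E`, globally minimal `E/ℚ`):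
# a bounded multiple lands in `E₁`, fixed torsion has bounded exponent, a fixed point of infinite
# order exists; hence `(ker red)^{Γ}[p^∞]` is finite and `(ker red)^{Γ} ≠ p·(ker red)^{Γ} + torsion`
# (team n1011, ROW T-GR34NA, seat p06 GEN 8, FILE 1 of 2 — the good-reduction siblings of p07's
# T-T3B F4 (F4.d)/(F4.e) and of the FixedLevel engine, referee-1 GEN 29 proviso "name the
# good-reduction sibling")

HONEST FRAMING (cell `b2b-bsdres-*`, team n1011, verbatim): prove what is provable now; shrink each
hard class to its core with data; no claim beyond stated classes. Research route; TOOL theorems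
only — no definition, no named fact, nothing booked, no residual-map mark moved, no class closed.

## What

p07 GEN 9's level-calculus engine `Additive/AdditiveFixedPointsFormalLevel` +
`Additive/AdditiveFixedPointsTorsion` (ns `…Additive.FixedLevel`) has exactly ONE reduction-type
input: `exists_transport_nsmul_mem_kernel (hpv) (hadd)` — a transport `Φ : E(K̄_v) ≃ X(K̄_v)` to an
integral elliptic model and ONE `N > 0` with `N • Φ R ∈ E₁(X)` for every `Γ_{ℚ_v}`-fixed `R`
(Kodaira–Néron at an ADDITIVE `v`). At a GOOD `v ∋ p` the same package holds with `X = E ⊗ ℚ_v`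
itself (integral: the minimal model has coefficients in `ℤ`), `Φ` the identity transport
`E(K̄_v) = (E ⊗ ℚ_v)(K̄_v)` (tree `congrEquiv_smul`), and `N = N₀` = the order of the (finite) image
of the fixed points under reduction (tree `exists_nsmul_localRed_eq_zero_of_fixed`: the reductions
fixed by a Frobenius form a finite set, "`E(ℚ_v)/E₁(ℚ_v) ↪ Ẽ(𝔽_p)`", Silverman VII.2.1; kernel of
reduction = `E₁` by `localRed_eq_zero_iff_mem_kernel`):

* `exists_transport_nsmul_mem_kernel_of_good` — the package at a good `v ∋ p`;
* `exists_nsmul_eq_zero_of_fixed_of_isOfFinAddOrder_of_good`,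
  `isOfFinAddOrder_of_forall_exists_fixed_of_good`, `exists_fixed_not_isOfFinAddOrder_of_good` —
  p07's three `Φ`-free exports, proofs VERBATIM with the good package in place of the additive one;
* `finite_fixed_primary_localRed_ker`, `exists_fixed_localRed_ker_not_pdivisible` — (F4.d)/(F4.e)
  for the reduction map `red = localRed W p hpv hΔ` of the minimal model
  (`X2/GreenbergVatsalReductionDatum`), proofs VERBATIM from p07's `GoodModelKernelRationalPoints`.

These are the binders `hTfin`, `hu` of p12's T-T3B F5 END
`GoodModelLine.localTowerKerPrimary_zero_eq_bot_of_goodModel` for the minimal model at a good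
`v`; FILE 2 (`Iwasawa/LocalTowerKernelAtPGoodOrdinary`) supplies `hmove` (a Frobenius of
`(ker κ)_v` moves `Ẽ[p]` iff `p ∤ #Ẽ(𝔽_p)`) and assembles Greenberg's Lemma 3.4 at `n = 0` in its
vanishing (non-anomalous) case. Hypotheses: `v ∋ p`, `p ∤ Δ_E` (`W` globally minimal); NO
ordinarity, NO `p ≥ 3` here. Axioms standard.

References: [SilvermanAEC2009] VII.2.1, VII.2.2, VII.3.1, IV.3.2, IV.6.4; [GreenbergLNM1716] §3
Lemma 3.4 (p. 89), Prop. 3.8 (p. 95); p07 GEN 9 `Additive/AdditiveFixedPointsTorsion`,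
`Additive/GoodModelKernelRationalPoints` (the additive originals); cells/n1011/skel/T-GR34NA.md.
-/

set_option autoImplicit false

noncomputable section

open scoped Classical NNReal

universe u

open NumberField IsDedekindDomain Field IsDedekindDomain.HeightOneSpectrum WeierstrassCurve
open Literature.NumberTheory.EllipticCurves Literature.NumberTheory.GaloisRepresentations
  Literature.NumberTheory.EllipticCurves.FormalGroupChart
  Summit.BirchSwinnertonDyer.Rank1Residual.X2.GreenbergVatsalReductionDatum
  Summit.BirchSwinnertonDyer.Rank1Residual.Additive
  Summit.BirchSwinnertonDyer.Rank1Residual.Additive.FixedLevel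

namespace Summit.BirchSwinnertonDyer.Rank1Residual.Iwasawa.GoodFixedLevel

variable (W : WeierstrassCurve ℚ) [W.IsElliptic] [W.IsGloballyMinimal] (p : ℕ) [hp : Fact p.Prime]
  {v : HeightOneSpectrum (𝓞 ℚ)}

/-! ### §0 The good-reduction package -/

/-- **The package at a GOOD `v ∋ p`** (sibling of p07's `FixedLevel.exists_transport_nsmul_mem_kernel`
at an additive `v`): the model `X = E ⊗ ℚ_v` (integral for `|·|_v` on `K̄_v` — the globally minimal
equation has integer coefficients — and elliptic), the identity transport
`Φ : E(K̄_v) = (E ⊗ ℚ_v)(K̄_v)` (`Γ_{ℚ_v}`-equivariant, `congrEquiv_smul`), and ONE `N > 0` with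
`N • Φ R ∈ E₁` for every `Γ_{ℚ_v}`-fixed `R`: `N = N₀`, the exponent of
`exists_nsmul_localRed_eq_zero_of_fixed` (the reductions of the fixed points form a finite group,
Silverman VII.2.1), `ker red = E₁` (`localRed_eq_zero_iff_mem_kernel`).
[cite: SilvermanAEC2009, Prop. VII.2.1 and Prop. VII.2.2] -/
theorem exists_transport_nsmul_mem_kernel_of_good (hpv : ((p : ℕ) : 𝓞 ℚ) ∈ v.asIdeal)
    (hΔ : ¬ (p : ℤ) ∣ minimalDiscriminantInt W) :
    ∃ (X : WeierstrassCurve (v.adicCompletion ℚ)) (hI : (X.baseChange (AlgebraicClosure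
        (v.adicCompletion ℚ))).IsIntegral (specVal v).integer)
      (_ : (X.baseChange (AlgebraicClosure (v.adicCompletion ℚ))).IsElliptic)
      (Φ : localPoints W (v.adicCompletion ℚ) ≃+ (X.baseChange (AlgebraicClosure (v.adicCompletion
          ℚ))).toAffine.Point)
      (N : ℕ), 0 < N ∧ (∀ (σ : absoluteGaloisGroup (v.adicCompletion ℚ)) (Q : localPoints W
          (v.adicCompletion ℚ)),
        Φ (σ • Q) = Affine.Point.map ((absoluteGaloisGroup.toAlgEquiv _ σ : (AlgebraicClosure
            (v.adicCompletion ℚ)) ≃ₐ[v.adicCompletion ℚ]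
              (AlgebraicClosure (v.adicCompletion ℚ))) : (AlgebraicClosure (v.adicCompletion ℚ))
                  →ₐ[v.adicCompletion ℚ] (AlgebraicClosure (v.adicCompletion ℚ))) (Φ Q)) ∧ (∀ R :
                  localPoints W (v.adicCompletion ℚ),
        (∀ σ : absoluteGaloisGroup (v.adicCompletion ℚ), σ • R = R) →
          (haveI := hI; N • Φ R ∈ kernel (specVal v) (X.baseChange (AlgebraicClosure
              (v.adicCompletion ℚ))))) := by
  have hw := specVal_spec v
  have hΔu : IsUnit ((integralModelInt W).map (algebraMap ℤ ↥(specVal v).valuationSubring)).Δ :=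
    isUnit_Δ_localIntModel W hpv hw hΔ
  obtain ⟨𝔐, h𝔐⟩ := v.localPrimesAbove_nonempty
  obtain ⟨τ, hτ⟩ := exists_isArithFrobAt_localAbsIntegers (v := v) h𝔐
  obtain ⟨N₀, hN₀, hN₀red⟩ := W.exists_nsmul_localRed_eq_zero_of_fixed hw hΔu (localRed W p hpv hΔ)
    (localRed_apply W p hpv hΔ) h𝔐 hτ
  haveI hV : (W.baseChange (AlgebraicClosure (v.adicCompletion ℚ))).IsIntegral (specVal v).integer :=
    ⟨⟨(integralModelInt W).map (algebraMap ℤ ↥(specVal v).integer),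
      W.baseChange_eq_localIntModel_integer_baseChange⟩⟩
  have hbb := baseChange_baseChange_adicCompletion W v
  haveI hI : ((W.baseChange (v.adicCompletion ℚ)).baseChange (AlgebraicClosure
      (v.adicCompletion ℚ))).IsIntegral (specVal v).integer := by
    rw [hbb]; exact hV
  haveI hE : ((W.baseChange (v.adicCompletion ℚ)).baseChange (AlgebraicClosure
      (v.adicCompletion ℚ))).IsElliptic := by
    rw [hbb]; infer_instance
  refine ⟨W.baseChange (v.adicCompletion ℚ), hI, hE, Affine.Point.congrEquiv hbb.symm, N₀, hN₀,
    fun σ Q ↦ congrEquiv_smul W v σ Q, fun R hR ↦ ?_⟩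
  have hmem : ((N₀ • R : localPoints W (v.adicCompletion ℚ)) :
      (W.baseChange (AlgebraicClosure (v.adicCompletion ℚ))).toAffine.Point) ∈
        kernel (specVal v) (W.baseChange (AlgebraicClosure (v.adicCompletion ℚ))) :=
    (W.localRed_eq_zero_iff_mem_kernel hΔu (localRed W p hpv hΔ) (localRed_apply W p hpv hΔ)
      (N₀ • R)).mp (hN₀red R hR)
  rw [← map_nsmul]
  obtain ⟨Q, hQ⟩ : ∃ Q : localPoints W (v.adicCompletion ℚ), Q = N₀ • R := ⟨_, rfl⟩
  rw [← hQ] at hmem ⊢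
  change (W.baseChange (AlgebraicClosure (v.adicCompletion ℚ))).toAffine.Point at Q
  change Affine.Point.congrEquiv hbb.symm Q ∈ _
  rcases Q with _ | ⟨x, y, h⟩
  · rw [← Affine.Point.zero_def, Affine.Point.congrEquiv_zero]
    exact @(AddSubgroup.zero_mem _)
  · rw [Affine.Point.congrEquiv_some]
    exact (some_mem_kernel_iff _).mpr ((some_mem_kernel_iff (w := specVal v) h).mp hmem)

/-! ### §1 The three `Φ`-free exports at a good `v` (p07's proofs verbatim) -/

/-- **ONE `N > 0` kills every `Γ_{ℚ_v}`-fixed torsion point of `E(K̄_v)`** at a GOOD `v ∋ p` (`p ∤ Δ_E`)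
(`N = p² N₀`): `p c • R ∈ E₁(X)` (§1), `p² c • R ∈ E₂(X)` (§2), and `E₂(X)` has no torsion.
[cite: SilvermanAEC2009, Thm. VII.6.1, Prop. VII.2.1, VII.2.2, VII.3.1] -/
theorem exists_nsmul_eq_zero_of_fixed_of_isOfFinAddOrder_of_good (hpv : ((p : ℕ) : 𝓞 ℚ) ∈ v.asIdeal)
    (hΔ : ¬ (p : ℤ) ∣ minimalDiscriminantInt W) :
    ∃ N : ℕ, 0 < N ∧ ∀ R : localPoints W (v.adicCompletion ℚ),
      (∀ σ : absoluteGaloisGroup (v.adicCompletion ℚ), σ • R = R) → IsOfFinAddOrder R → N • R = 0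
          := by
  obtain ⟨X, hI, hE, Φ, N, hN, hΦ, hker⟩ := exists_transport_nsmul_mem_kernel_of_good W p hpv hΔ
  haveI := hI
  have hw := specVal_spec v
  haveI : CharZero (AlgebraicClosure (v.adicCompletion ℚ)) := charZero_of_injective_algebraMap
      (algebraMap ℚ _).injective
  obtain ⟨hp0, hp1⟩ := val_p_pos_lt_one p hpv
  refine ⟨p * N, Nat.mul_pos hp.out.pos hN, fun R hR hRtor ↦ ?_⟩
  -- `Q = Φ (N • R) ∈ E₁(X)` is fixed
  have hQ' : N • Φ R ∈ kernel (specVal v) (X.baseChange (AlgebraicClosure (v.adicCompletion ℚ)))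
      := hker R hR
  have hQ : Φ (N • R) ∈ kernel (specVal v) (X.baseChange (AlgebraicClosure (v.adicCompletion ℚ)))
      := by
    rw [map_nsmul]; exact @hQ'
  obtain ⟨hpQ, hzle⟩ := nsmul_mem_kernel_and_val_zCoord_le_sq p hpv hQ
    (map_transport_nsmul_eq_of_fixed W Φ hΦ hR N)
  have hzlt : specVal v (p • Φ (N • R)).zCoord < specVal v (p : (AlgebraicClosure
      (v.adicCompletion ℚ))) :=
    lt_of_le_of_lt hzle (by rw [sq]; exact mul_lt_of_lt_one_left hp0 hp1)
  -- the order of `R` kills `p • Q`, which is therefore `O`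
  have hm := hRtor.addOrderOf_pos
  have hmQ : addOrderOf R • (p • Φ (N • R)) = 0 := by
    rw [← map_nsmul, ← map_nsmul, smul_comm (addOrderOf R) p (N • R), smul_comm (addOrderOf R) N R,
      addOrderOf_nsmul_eq_zero, smul_zero, smul_zero, map_zero]
  have h0 := eq_zero_of_nsmul_eq_zero_of_val_zCoord_lt p hpv hpQ hzlt hm hmQ
  rw [← map_nsmul, ← mul_smul, Φ.map_eq_zero_iff] at h0
  exact h0

/-- **A point `pⁿ`-divisible modulo torsion by `Γ_{ℚ_v}`-fixed points for EVERY `n` is torsion**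
(additive `v ∋ p`): with `K = N₁·p·N`, `K • R = pⁿ • (K • cₙ)` and `Φ(K • cₙ) ∈ E₂(X)`, so
`|z(Φ(K • R))| ≤ |p|ⁿ` for all `n`; `|p| < 1` forces `z = 0`, i.e. `K • R = 0` (the valuation form
of "`⋂ₙ (pⁿE(ℚ_v) + torsion) = torsion`"). [cite: SilvermanAEC2009, Prop. VII.2.2 and Prop. VII.6.3]
[cite: GreenbergLNM1716, §3 Lemma 3.4 (p. 89)] -/
theorem isOfFinAddOrder_of_forall_exists_fixed_of_good (hpv : ((p : ℕ) : 𝓞 ℚ) ∈ v.asIdeal)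
    (hΔ : ¬ (p : ℤ) ∣ minimalDiscriminantInt W) {R : localPoints W (v.adicCompletion ℚ)}
    (h : ∀ n : ℕ, ∃ c t : localPoints W (v.adicCompletion ℚ),
      (∀ σ : absoluteGaloisGroup (v.adicCompletion ℚ), σ • c = c) ∧
      (∀ σ : absoluteGaloisGroup (v.adicCompletion ℚ), σ • t = t) ∧ IsOfFinAddOrder t ∧ R = p ^ n
          • c + t) :
    IsOfFinAddOrder R := by
  obtain ⟨X, hI, hE, Φ, N, hN, hΦ, hker⟩ := exists_transport_nsmul_mem_kernel_of_good W p hpv hΔ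
  haveI := hI
  obtain ⟨N₁, hN₁, htor⟩ := exists_nsmul_eq_zero_of_fixed_of_isOfFinAddOrder_of_good W p hpv hΔ
  have hw := specVal_spec v
  haveI : CharZero (AlgebraicClosure (v.adicCompletion ℚ)) := charZero_of_injective_algebraMap
      (algebraMap ℚ _).injective
  obtain ⟨hp0, hp1⟩ := val_p_pos_lt_one p hpv
  have hunit : ∀ n : ℕ, ¬ p ∣ n → specVal v (n : (AlgebraicClosure (v.adicCompletion ℚ))) = 1 :=
    fun n hn ↦ spectralValuation_natCast_eq_one_of_not_dvd hpv hw hn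
  -- for a fixed `c`: `N₁ • p • Φ (N • c) ∈ E₁(X)` with `|z| ≤ |p|²`
  have step : ∀ c : localPoints W (v.adicCompletion ℚ),
      (∀ σ : absoluteGaloisGroup (v.adicCompletion ℚ), σ • c = c) →
      (N₁ • p • Φ (N • c)) ∈ kernel (specVal v) (X.baseChange (AlgebraicClosure (v.adicCompletion
          ℚ))) ∧
        specVal v (N₁ • p • Φ (N • c)).zCoord ≤ specVal v (p : (AlgebraicClosure (v.adicCompletion
            ℚ))) ^ 2 := by
    intro c hc
    have hQ' : N • Φ c ∈ kernel (specVal v) (X.baseChange (AlgebraicClosure (v.adicCompletion ℚ)))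
        := hker c hc
    have hQ : Φ (N • c) ∈ kernel (specVal v) (X.baseChange (AlgebraicClosure (v.adicCompletion
        ℚ))) := by
      rw [map_nsmul]; exact @hQ'
    obtain ⟨hpQ, hzle⟩ := nsmul_mem_kernel_and_val_zCoord_le_sq p hpv hQ
      (map_transport_nsmul_eq_of_fixed W Φ hΦ hc N)
    obtain ⟨hN₁Q, hzle', -⟩ := val_zCoord_nsmul (w := specVal v)
      (V := X.baseChange (AlgebraicClosure (v.adicCompletion ℚ))) N₁ hpQ
    exact ⟨hN₁Q, hzle'.trans hzle⟩
  -- the point `S = Φ (K • R)` and its valuation bound for every `n`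
  set S : (X.baseChange (AlgebraicClosure (v.adicCompletion ℚ))).toAffine.Point := Φ ((N₁ * (p *
      N)) • R) with hS
  have hSn : ∀ n : ℕ, S ∈ kernel (specVal v) (X.baseChange (AlgebraicClosure (v.adicCompletion
      ℚ))) ∧
      specVal v S.zCoord ≤ specVal v (p : (AlgebraicClosure (v.adicCompletion ℚ))) ^ n := by
    intro n
    obtain ⟨c, t, hc, ht, httor, hRct⟩ := h n
    obtain ⟨hmem, hz⟩ := step c hc
    have hKt : (N₁ * (p * N)) • t = 0 := by
      rw [mul_comm, mul_smul, htor t ht httor, smul_zero]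
    have hSe : S = p ^ n • (N₁ • p • Φ (N • c)) := by
      rw [hS, hRct, smul_add, hKt, add_zero, smul_comm (N₁ * (p * N)) (p ^ n) c, map_nsmul,
          mul_smul,
        mul_smul, map_nsmul, map_nsmul]
    have hpn : p ^ n ≠ 0 := pow_ne_zero n hp.out.ne_zero
    have hzlt : specVal v (N₁ • p • Φ (N • c)).zCoord < specVal v (p : (AlgebraicClosure
        (v.adicCompletion ℚ))) :=
      lt_of_le_of_lt hz (by rw [sq]; exact mul_lt_of_lt_one_left hp0 hp1)
    have hval := val_zCoord_nsmul_eq (w := specVal v)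
      (V := X.baseChange (AlgebraicClosure (v.adicCompletion ℚ))) hp.out hunit (p ^ n) hpn hmem hzlt
    have hmemS : p ^ n • (N₁ • p • Φ (N • c)) ∈ kernel (specVal v) (X.baseChange (AlgebraicClosure
        (v.adicCompletion ℚ))) :=
      (val_zCoord_nsmul (w := specVal v) (V := X.baseChange (AlgebraicClosure (v.adicCompletion ℚ)))
        (p ^ n) hmem).1
    refine ⟨by rw [hSe]; exact @hmemS, ?_⟩
    rw [hSe, hval, Nat.cast_pow, map_pow]
    calc specVal v (p : (AlgebraicClosure (v.adicCompletion ℚ))) ^ n *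
          specVal v (N₁ • p • Φ (N • c)).zCoord
        ≤ specVal v (p : (AlgebraicClosure (v.adicCompletion ℚ))) ^ n * 1 := mul_le_mul' le_rfl
            (hz.trans (pow_le_one₀ zero_le hp1.le))
      _ = specVal v (p : (AlgebraicClosure (v.adicCompletion ℚ))) ^ n := mul_one _
  -- hence `z(S) = 0`, `S = 0`, `K • R = 0`
  have hzS : specVal v S.zCoord = 0 := by
    by_contra hne
    have hpos : 0 < specVal v S.zCoord := pos_iff_ne_zero.mpr hne
    obtain ⟨n, hn⟩ := exists_pow_lt_of_lt_one hpos hp1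
    exact absurd (hSn n).2 (not_le.mpr hn)
  have hS0 : S = 0 :=
    (zCoord_eq_zero_iff (w := specVal v) (hSn 0).1).mp ((Valuation.zero_iff _).mp hzS)
  rw [hS, Φ.map_eq_zero_iff] at hS0
  exact isOfFinAddOrder_iff_nsmul_eq_zero.mpr
    ⟨N₁ * (p * N), Nat.mul_pos hN₁ (Nat.mul_pos hp.out.pos hN), hS0⟩

/-- **A `Γ_{ℚ_v}`-fixed point of `E(K̄_v)` of infinite order** at a GOOD `v ∋ p` (`p ∤ Δ_E`): Hensel's point
of `E₁(X)` with `z = p²` (tree `exists_mem_kernel_zCoord_eq`) is fixed by every `|·|_v`-isometry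
fixing `p²`, and lies in the torsion-free `E₂(X)`. [cite: SilvermanAEC2009, Prop. VII.2.2] -/
theorem exists_fixed_not_isOfFinAddOrder_of_good (hpv : ((p : ℕ) : 𝓞 ℚ) ∈ v.asIdeal)
    (hΔ : ¬ (p : ℤ) ∣ minimalDiscriminantInt W) :
    ∃ u : localPoints W (v.adicCompletion ℚ),
      (∀ σ : absoluteGaloisGroup (v.adicCompletion ℚ), σ • u = u) ∧ ¬ IsOfFinAddOrder u := by
  obtain ⟨X, hI, hE, Φ, N, -, hΦ, -⟩ := exists_transport_nsmul_mem_kernel_of_good W p hpv hΔ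
  haveI := hI
  haveI := hE
  have hw := specVal_spec v
  haveI : CharZero (AlgebraicClosure (v.adicCompletion ℚ)) := charZero_of_injective_algebraMap
      (algebraMap ℚ _).injective
  obtain ⟨hp0, hp1⟩ := val_p_pos_lt_one p hpv
  have hp2 : specVal v ((p : (AlgebraicClosure (v.adicCompletion ℚ))) ^ 2) < 1 := by
    rw [map_pow]; exact pow_lt_one₀ zero_le hp1 two_ne_zero
  obtain ⟨P, hPker, hPz, hPfix⟩ := exists_mem_kernel_zCoord_eq (w := specVal v) X hp2
  refine ⟨Φ.symm P, fun σ ↦ ?_, fun htor ↦ ?_⟩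
  · apply Φ.injective
    rw [hΦ σ, AddEquiv.apply_symm_apply]
    exact hPfix _ (fun z ↦ spectralValuation_smul hw σ z) (by rw [map_pow, map_natCast])
  · have hm := htor.addOrderOf_pos
    have hmP : addOrderOf (Φ.symm P) • P = 0 := by
      have h := congrArg Φ (addOrderOf_nsmul_eq_zero (Φ.symm P))
      rwa [map_nsmul, AddEquiv.apply_symm_apply, map_zero] at h
    have hzlt : specVal v P.zCoord < specVal v (p : (AlgebraicClosure (v.adicCompletion ℚ))) := by
      rw [hPz, map_pow, sq]; exact mul_lt_of_lt_one_left hp0 hp1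
    have hP0 := eq_zero_of_nsmul_eq_zero_of_val_zCoord_lt p hpv hPker hzlt hm hmP
    have hz0 : P.zCoord = 0 := by rw [hP0, WeierstrassCurve.Affine.Point.zCoord_zero]
    rw [hPz] at hz0
    exact pow_ne_zero 2 (Nat.cast_ne_zero.mpr hp.out.ne_zero) hz0

/-! ### §2 (F4.d)/(F4.e) for `red = localRed` at a good `v` (p07's proofs verbatim) -/

/-- **(F4.d) The `Γ_{ℚ_v}`-fixed `p`-power torsion of `ker red` is FINITE** at a GOOD `v ∋ p`:
ONE `N > 0` kills every fixed torsion point of `E(K̄_v)`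
(`FixedLevel.exists_nsmul_eq_zero_of_fixed_of_isOfFinAddOrder`: Kodaira–Néron + level calculus on
the minimal model), and `E(K̄_v)[N]` is finite (tree `finite_torsionBy_of_isAlgClosed`). (The
condition `red P = Õ` is not even used.) Hypothesis `hTfin` of p12's F2.
[cite: SilvermanAEC2009, Thm. VII.6.1, Prop. VII.2.2, VII.3.1 and Cor. III.6.4] -/
theorem finite_fixed_primary_localRed_ker (hpv : ((p : ℕ) : 𝓞 ℚ) ∈ v.asIdeal)
    (hΔ : ¬ (p : ℤ) ∣ minimalDiscriminantInt W) :
    Set.Finite {P : localPoints W (v.adicCompletion ℚ) | localRed W p hpv hΔ P = 0 ∧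
      (∀ σ : absoluteGaloisGroup (v.adicCompletion ℚ), σ • P = P) ∧ ∃ k : ℕ, p ^ k • P = 0} := by
  obtain ⟨N, hN, hkill⟩ := exists_nsmul_eq_zero_of_fixed_of_isOfFinAddOrder_of_good W p hpv hΔ
  have hN0 : (N : ℤ) ≠ 0 := by exact_mod_cast hN.ne'
  haveI : Finite (AddSubgroup.torsionBy (localPoints W (v.adicCompletion ℚ)) (N : ℤ)) :=
    finite_torsionBy_of_isAlgClosed (V := W.baseChange (AlgebraicClosure (v.adicCompletion ℚ))) hN0
  refine Set.Finite.subset ((AddSubgroup.torsionBy (localPoints W (v.adicCompletion ℚ)) (N : ℤ) :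
      Set (localPoints W (v.adicCompletion ℚ))).toFinite) (fun P hP ↦ ?_)
  obtain ⟨-, hfix, k, hk⟩ := hP
  have htor : IsOfFinAddOrder P :=
    isOfFinAddOrder_iff_nsmul_eq_zero.mpr ⟨p ^ k, pow_pos hp.out.pos k, hk⟩
  change P ∈ AddSubgroup.torsionBy (localPoints W (v.adicCompletion ℚ)) (N : ℤ)
  rw [mem_torsionBy_iff, natCast_zsmul]
  exact hkill P hfix htor

/-- **(F4.e) `Q ≠ pQ + Q[p^∞]` for `Q =` the `Γ_{ℚ_v}`-fixed points of `ker red`** at a GOOD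
`v ∋ p`: there is a fixed `u` with `red u = Õ` which is NOT of the form `p • c + t` with `c` fixed in
`ker red` and `t` fixed `p`-power torsion in `ker red`. Otherwise, by induction, every fixed kernel point
is `pⁿ • cₙ + tₙ` for every `n` (with `cₙ` fixed, `tₙ` fixed torsion), hence torsion
(`FixedLevel.isOfFinAddOrder_of_forall_exists_fixed`); but the fixed point of infinite order of
`FixedLevel.exists_fixed_not_isOfFinAddOrder`, multiplied into `ker red` by (F4.c), is such a point.
Hypothesis `hu` of p12's F2 (the non-divisible direction of the Kummer count).
[cite: SilvermanAEC2009, Prop. VII.2.2 and Prop. VII.6.3] [cite: GreenbergLNM1716, §3 Lemma 3.4 (p. 89)] -/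
theorem exists_fixed_localRed_ker_not_pdivisible (hpv : ((p : ℕ) : 𝓞 ℚ) ∈ v.asIdeal)
    (hΔ : ¬ (p : ℤ) ∣ minimalDiscriminantInt W) :
    ∃ u : localPoints W (v.adicCompletion ℚ), localRed W p hpv hΔ u = 0 ∧
      (∀ σ : absoluteGaloisGroup (v.adicCompletion ℚ), σ • u = u) ∧
      ∀ c t : localPoints W (v.adicCompletion ℚ), localRed W p hpv hΔ c = 0 →
        (∀ σ : absoluteGaloisGroup (v.adicCompletion ℚ), σ • c = c) → localRed W p hpv hΔ t = 0 →
        (∀ σ : absoluteGaloisGroup (v.adicCompletion ℚ), σ • t = t) → (∃ k : ℕ, p ^ k • t = 0) →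
        u ≠ p • c + t := by
  obtain ⟨u₀, hu₀fix, hu₀tor⟩ := exists_fixed_not_isOfFinAddOrder_of_good W p hpv hΔ
  obtain ⟨n, hn, hnu⟩ := GoodModelLine.exists_nsmul_red_eq_zero W (localRed W p hpv hΔ) u₀
  have hu₁fix : ∀ σ : absoluteGaloisGroup (v.adicCompletion ℚ), σ • (n • u₀) = n • u₀ :=
    fun σ ↦ by rw [smul_comm, hu₀fix σ]
  by_contra hcon
  push Not at hcon
  -- every fixed kernel point is `pᵐ`-divisible modulo fixed torsion, for every `m`
  have key : ∀ (m : ℕ) (u : localPoints W (v.adicCompletion ℚ)), localRed W p hpv hΔ u = 0 →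
      (∀ σ : absoluteGaloisGroup (v.adicCompletion ℚ), σ • u = u) →
      ∃ c t : localPoints W (v.adicCompletion ℚ),
        (∀ σ : absoluteGaloisGroup (v.adicCompletion ℚ), σ • c = c) ∧
        (∀ σ : absoluteGaloisGroup (v.adicCompletion ℚ), σ • t = t) ∧ IsOfFinAddOrder t ∧
        u = p ^ m • c + t := by
    intro m
    induction m with
    | zero =>
      intro u _ hfix
      exact ⟨u, 0, hfix, fun σ ↦ smul_zero σ, IsOfFinAddOrder.zero,
        by rw [pow_zero, one_smul, add_zero]⟩
    | succ m ih =>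
      intro u hu hfix
      obtain ⟨c, t, hc, hcfix, ht, htfix, ⟨k, hk⟩, rfl⟩ := hcon u hu hfix
      obtain ⟨c', t', hc'fix, ht'fix, ht'tor, hceq⟩ := ih c hc hcfix
      refine ⟨c', p • t' + t, hc'fix, fun σ ↦ ?_, ?_, ?_⟩
      · rw [smul_add, smul_comm, ht'fix σ, htfix σ]
      · exact (ht'tor.nsmul : IsOfFinAddOrder (p • t')).add
          (isOfFinAddOrder_iff_nsmul_eq_zero.mpr ⟨p ^ k, pow_pos hp.out.pos k, hk⟩)
      · rw [hceq, smul_add, ← mul_smul, ← pow_succ', add_assoc]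
  have htor : IsOfFinAddOrder (n • u₀) :=
    isOfFinAddOrder_of_forall_exists_fixed_of_good W p hpv hΔ fun m ↦ key m (n • u₀) hnu hu₁fix
  obtain ⟨m, hm, hmu⟩ := isOfFinAddOrder_iff_nsmul_eq_zero.mp htor
  exact hu₀tor (isOfFinAddOrder_iff_nsmul_eq_zero.mpr ⟨m * n, Nat.mul_pos hm hn, by rw [mul_smul, hmu]⟩)

end Summit.BirchSwinnertonDyer.Rank1Residual.Iwasawa.GoodFixedLevel

end
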